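import Summits.Ventures.QEC.Theses.BB144DistanceCertificate
import HarnessLib

/-!
# `[[144,12,12]]` route — the ASSEMBLY item (stmt-Ventures-19775)

`Assembly := NoZLogicalBelowTwelve → WeightTwelveZLogical → TwelveLogicalQubits144 → BB144_12_12_claim`
is exactly the implication the route's deciding theorem `closes` proves (lower bound + weight-12 witness
⇒ `d^Z(BB.bb144) = 12` by `CSSCode.dZ_eq_of_witness`; `n = 144` by counting; `k = 12`; then
`hasParams_of_dZ`, Bravyi et al. Lemma 1 `d = d^Z`). HONEST FRAMING: this file certifies nothing about
the code by itself — it records that the three crux items suffice; the claim `BB144_12_12_claim` becomes a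
theorem only when `NoZLogicalBelowTwelve` (the P1 Brouwer–Zimmermann certificate) lands.
-/

namespace Summit.Ventures.QEC.Theorems

/-- **Assembly of route `BB144DistanceCertificate`**: the three items imply the `[[144,12,12]]` claim
(by the route's deciding theorem `closes`). [proved] -/
theorem bb144DistanceCertificate_assembly_proof :
    Summit.Ventures.QEC.Theses.BB144DistanceCertificate.Assembly :=
  fun hL hU hK => Summit.Ventures.QEC.Theses.BB144DistanceCertificate.closes hL hU hK

end Summit.Ventures.QEC.Theorems
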